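import Summits.HodgeConjecture.HodgeConjecture.Theorems.F0P3cStCharTSEllCartanCompact   -- (this seat) ★ p851477 «ELL-CARTAN-COMPACT★»: `exists_conj_cmTorus_of_not_isCompact_centralizer`; brings ★ S9a CartanFields, ★ (H3) HyperbolicCore, ★ HyperbolicSet, ★ TorusRay
import HarnessLib

/-!
# F0 · P3c · line LH6 «StCharTS» — «CARTAN-REPS★»: normalising an ABSTRACT finite family of Cartan representatives of `U(Φ₃)(L⁺_v)` to the shape `{M} ∪ {compact}`
# (what the named fact «CARTAN-FIN» must say for the datum's `cartanAll = insert M cartanG`) [Rogawski1990, §3.6 pp. 28–31; §12.5 pp. 182, 184]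

Cell `pub/hodgecm-mathlib`, crux H413 = `stmt-HodgeConjecture-24833` (lane `--supports … --as helper`), route HCCMUnconditional; seat F0P3a-p03 (g23); census-first default
«CARTAN-REPS-NORMALISE★» (datum road of the (S-𝔇) organ, map owner LH6-p01 (g4), PLAN S9 §1 D2 ∕ N1; announced 2026-09-02T12:51Z).  THEOREMS ONLY (no definition ∕ instance ∕
notation ∕ named fact ∕ `sorry`); ★-only imports.  Conjugate subgroups are spelled membership-wise, `∀ g, g ∈ T' ↔ x⁻¹ g x ∈ T` («`T' = x T x⁻¹`»), as in ★ ELL-CARTAN-COMPACT.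

WHAT.  The carpets of the §12.5 datum sum over `cartanAll` = «a set of representatives for the conjugacy classes of Cartan subgroups» (p. 182) and over `cartanG` = the elliptic
ones (p. 184); ★ S9a `F0P3cStCharTSCartanFields` consumes the SHAPE `cartanAll = insert M cartanG` with every member of `cartanG` a COMPACT centraliser `Z(γ₀)` of a regular
element (`hAll`, `hcart`).  The named fact N1 «CARTAN-FIN» [§3.6; PlatonovRapinchuk1994 §6.4] need only say, abstractly, that finitely many Cartan subgroups `Z(γ)` meet every
conjugacy class.  This file supplies the in-house normalisation from the abstract statement to the consumed shape (`U = U(Φ₃)(L⁺_v)`, `v` NON-SPLIT, `M` the split torus):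
* §1 `isCompact_iff_of_forall_mem_iff_conj` — conjugate subgroups are simultaneously compact (conjugation is a homeomorphism); **`not_conj_cmTorus_of_isCompact`** — a COMPACT
  subgroup is not conjugate to `M` (★ `not_isCompact_cmTorus`);
* §2 **`exists_isRegularElt_centralizer_eq_cmTorus`** — `M` IS a Cartan subgroup: `M = Z(m₀)` for the regular `m₀ = ι(ϖ, 1) ∈ M` (★ (H2c)+(H3): `|tr m₀|_w > 1` ⇒ `m₀ ∈ Ω ⊆ G^r`;
  ★ `centralizer_eq_cmTorus_of_isRegularElt`);
* §3 **`conj_cmTorus_or_exists_isCompact_of_cover`** — if a finite family `S` of subgroups meets the conjugacy class of EVERY Cartan subgroup `Z(γ)` (`γ` regular), then for every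
  regular `γ` EITHER `Z(γ) = x M x⁻¹` (with `γ = x m x⁻¹`, `m ∈ M` regular) OR `Z(γ) = x T x⁻¹` for a COMPACT `T ∈ S` — by ★ «ELL-CARTAN-COMPACT★»
  (`exists_conj_cmTorus_of_not_isCompact_centralizer`) in the non-compact case; so `insert M (compact members of S)` again meets every class, and by §1 its members other than
  `M` are not conjugate to `M`: the `{M} ∪ {compact}` shape is no loss of generality.
* §4 **`exists_normalised_cartan_family`** — the consumable `∃ S'` form: `M ∈ S'`, every other member is a compact member of `S`, every member is some `Z(γ)`, `S'` meets
  every class, no member other than `M` is conjugate to `M`.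
HONEST LABEL: HC_CM is proved only modulo the 7 printed citations (2 remaining named inputs: hLiu418 = `stmt-HodgeConjecture-24832`, h413 = `stmt-HodgeConjecture-24833`)
until rung 0 closes; this file closes no organ (count-neutral constructor-side asset; the finiteness itself stays the named fact N1).

## References
* [Rogawski1990] J. D. Rogawski, *Automorphic Representations of Unitary Groups in Three Variables*, Ann. of Math. Stud. 123 (1990): §3.6 pp. 28–31 (the four types of Cartan
  subgroups of `U(3)`; type (0) is `M`, types (1)–(3) are compact modulo the centre); §12.5 p. 182 (representatives of the conjugacy classes of Cartan subgroups), p. 184.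
* [PlatonovRapinchuk1994] V. Platonov, A. Rapinchuk, *Algebraic Groups and Number Theory* (1994), §6.4 (finiteness of conjugacy classes of maximal tori over local fields), §3.3.
-/

set_option autoImplicit false
-- the mandated namespace has the single-problem summit's repeated segment (`HodgeConjecture.HodgeConjecture`)
set_option linter.dupNamespace false

noncomputable section

open NumberField IsDedekindDomain Filter Topology
open scoped Matrix MatrixGroups
open Literature.NumberTheory.Rogawski1990 Literature.NumberTheory.Automorphic Literature.NumberTheory.Automorphic.UnitaryGroup
open Summit.HodgeConjecture.HodgeConjecture.Cruxes.H413.F0P3cStCharTSTorusDefs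
open Summit.HodgeConjecture.HodgeConjecture.Cruxes.H413.F0P3cStCharTSHyperbolicSet
open Summit.HodgeConjecture.HodgeConjecture.Cruxes.H413.F0P3cStCharTSHyperbolicCore
open Summit.HodgeConjecture.HodgeConjecture.Cruxes.H413.F0P3cStCharTSCartanFields
open Summit.HodgeConjecture.HodgeConjecture.Cruxes.H413.F0P3cStCharTSEllCartanCompact

namespace Summit.HodgeConjecture.HodgeConjecture.Cruxes.H413.F0P3cStCharTSCartanReps

/-! ## §1 Conjugate subgroups: compactness transfers; a compact subgroup is not conjugate to the split torus `M` -/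

section Conj

variable {G : Type*} [Group G] [TopologicalSpace G] [IsTopologicalGroup G]

omit [TopologicalSpace G] [IsTopologicalGroup G] in
/-- If `T' = x T x⁻¹` membership-wise (`g ∈ T' ↔ x⁻¹ g x ∈ T`), then `T'` is the image of `T` under the homeomorphism `g ↦ x g x⁻¹`. [folklore] -/
theorem coe_eq_image_conj_of_forall_mem_iff {T T' : Subgroup G} {x : G} (h : ∀ g : G, g ∈ T' ↔ x⁻¹ * g * x ∈ T) :
    (T' : Set G) = (fun g : G => x * g * x⁻¹) '' (T : Set G) := by
  ext g
  simp only [SetLike.mem_coe, Set.mem_image]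
  constructor
  · intro hg
    refine ⟨x⁻¹ * g * x, (h g).1 hg, by group⟩
  · rintro ⟨t, ht, rfl⟩
    refine (h _).2 ?_
    have h1 : x⁻¹ * (x * t * x⁻¹) * x = t := by group
    rw [h1]
    exact ht

/-- **Conjugate subgroups are simultaneously compact** (conjugation is a homeomorphism). [folklore] -/
theorem isCompact_iff_of_forall_mem_iff_conj {T T' : Subgroup G} {x : G} (h : ∀ g : G, g ∈ T' ↔ x⁻¹ * g * x ∈ T) :
    IsCompact (T' : Set G) ↔ IsCompact (T : Set G) := by
  have hc : Continuous fun g : G => x * g * x⁻¹ := (continuous_const.mul continuous_id).mul continuous_const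
  have hc' : Continuous fun g : G => x⁻¹ * g * x := (continuous_const.mul continuous_id).mul continuous_const
  have h' : ∀ g : G, g ∈ T ↔ x⁻¹⁻¹ * g * x⁻¹ ∈ T' := fun g => by
    rw [inv_inv, h]
    have h1 : x⁻¹ * (x * g * x⁻¹) * x = g := by group
    rw [h1]
  constructor
  · intro hT'
    rw [coe_eq_image_conj_of_forall_mem_iff h']
    simpa only [inv_inv] using hT'.image hc'
  · intro hT
    rw [coe_eq_image_conj_of_forall_mem_iff h]
    exact hT.image hc

end Conj

section U3

variable (L : Type) [Field L] [NumberField L] [IsCMField L] (v : HeightOneSpectrum (𝓞 ↥(maximalRealSubfield L)))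

/-- **A COMPACT subgroup of `U(Φ₃)(L⁺_v)` is not conjugate to the split torus `M`** (`M ≅ E_vˣ × E¹_v` is not compact, ★ `not_isCompact_cmTorus`). [cite: Rogawski1990, §3.6 pp. 28–31; §12.2 p. 173] -/
theorem not_conj_cmTorus_of_isCompact {T : Subgroup ↥(unitaryGroupOfForm (conjLocal L (IsCMField.complexConj L) v) (cmLocalForm L 3 v))}
    (hT : IsCompact (T : Set ↥(unitaryGroupOfForm (conjLocal L (IsCMField.complexConj L) v) (cmLocalForm L 3 v))))
    (x : ↥(unitaryGroupOfForm (conjLocal L (IsCMField.complexConj L) v) (cmLocalForm L 3 v))) :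
    ¬ ∀ g : ↥(unitaryGroupOfForm (conjLocal L (IsCMField.complexConj L) v) (cmLocalForm L 3 v)), g ∈ T ↔ x⁻¹ * g * x ∈ (cmBorelTriple L 3 v).M := by
  intro h
  have h' : ∀ g : ↥(unitaryGroupOfForm (conjLocal L (IsCMField.complexConj L) v) (cmLocalForm L 3 v)), g ∈ (cmBorelTriple L 3 v).M ↔ x⁻¹⁻¹ * g * x⁻¹ ∈ T := fun g => by
    rw [inv_inv, h]
    have h1 : x⁻¹ * (x * g * x⁻¹) * x = g := by group
    rw [h1]
  exact not_isCompact_cmTorus L v ((isCompact_iff_of_forall_mem_iff_conj h').2 hT)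

/-! ## §2 `M` is a Cartan subgroup: `M = Z(m₀)` for a regular `m₀ ∈ M` -/

/-- **`M = Z(m₀)` for a REGULAR `m₀ ∈ M`** (`v` non-split): `m₀ = ι(ϖ, 1)` for a uniformiser `ϖ` has `|tr m₀|_w > 1` (★ (H2c) `one_lt_v_trace_torusChart_iff`), hence is regular
(★ (H3)), and the centraliser of a regular element of `M` is `M` (★ `centralizer_eq_cmTorus_of_isRegularElt`). [cite: Rogawski1990, §3.6 p. 28; §12.2 p. 173] -/
theorem exists_isRegularElt_centralizer_eq_cmTorus (hns : ∀ w : PlacesOver L v, IsCMField.complexConj L • w.1 = w.1) :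
    ∃ m₀ : ↥(unitaryGroupOfForm (conjLocal L (IsCMField.complexConj L) v) (cmLocalForm L 3 v)),
      m₀ ∈ (cmBorelTriple L 3 v).M ∧ IsRegularElt (m₀ : GL (Fin 3) (LocalRing L v)) ∧
      Subgroup.centralizer ({m₀} : Set ↥(unitaryGroupOfForm (conjLocal L (IsCMField.complexConj L) v) (cmLocalForm L 3 v))) = (cmBorelTriple L 3 v).M := by
  obtain ⟨w⟩ := (inferInstance : Nonempty (PlacesOver L v))
  obtain ⟨ϖ, hϖ⟩ := F0P3cStCharTSTorusRay.exists_uniformizer_units L v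
  set m₀ : ↥(cmBorelTriple L 3 v).M := torusChart L v (ϖ, 1) with hm₀
  have hne : Valued.v ((((ϖ, (1 : ↥(normOneUnits (conjLocal L (IsCMField.complexConj L) v)))) :
      (LocalRing L v)ˣ × ↥(normOneUnits (conjLocal L (IsCMField.complexConj L) v))).1 : LocalRing L v) w) ≠ 1 := by
    rw [hϖ w, ← WithZero.exp_zero, Ne, WithZero.exp_inj]
    norm_num
  have htr := (one_lt_v_trace_torusChart_iff L v hns w (ϖ, 1)).2 hne
  have hreg := (mem_hyperbolicSet_of_one_lt_v_trace L v hns w _ htr).2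
  exact ⟨(m₀ : ↥(unitaryGroupOfForm (conjLocal L (IsCMField.complexConj L) v) (cmLocalForm L 3 v))), m₀.2, hreg,
    F0P3cStCharTSWeylHypCM.centralizer_eq_cmTorus_of_isRegularElt L v m₀.2 hreg⟩

/-! ## §3 From an abstract finite family of representatives to the shape `{M} ∪ {compact}` -/

set_option maxHeartbeats 800000 in  -- statement-level `whnf` on the CM carriers
/-- **Normalising an abstract family of Cartan representatives.**  Let `S` be any finite family of subgroups of `U(Φ₃)(L⁺_v)` (`v` non-split) meeting the conjugacy
class of every Cartan subgroup: for every regular `γ` some conjugate `x T x⁻¹`, `T ∈ S`, is `Z(γ)`.  Then for every regular `γ`: EITHER `γ = x m x⁻¹` with `m ∈ M` regular and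
`Z(γ) = x M x⁻¹`, OR `Z(γ) = x T x⁻¹` for a COMPACT `T ∈ S` (★ «ELL-CARTAN-COMPACT★»: a non-compact Cartan subgroup is conjugate to `M`; a compact one is conjugate only to compact
members of `S`, §1).  Hence `insert M {T ∈ S | T compact}` meets every class as well — the shape `cartanAll = insert M cartanG` of ★ S9a — and its compact members are NOT
conjugate to `M` (`not_conj_cmTorus_of_isCompact`). [cite: Rogawski1990, §3.6 pp. 28–31; §12.5 pp. 182, 184] [cite: PlatonovRapinchuk1994, §6.4] -/
theorem conj_cmTorus_or_exists_isCompact_of_cover (hns : ∀ w : PlacesOver L v, IsCMField.complexConj L • w.1 = w.1)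
    (S : Finset (Subgroup ↥(unitaryGroupOfForm (conjLocal L (IsCMField.complexConj L) v) (cmLocalForm L 3 v))))
    (hcov : ∀ γ : ↥(unitaryGroupOfForm (conjLocal L (IsCMField.complexConj L) v) (cmLocalForm L 3 v)), IsRegularElt (γ : GL (Fin 3) (LocalRing L v)) →
      ∃ T ∈ S, ∃ x : ↥(unitaryGroupOfForm (conjLocal L (IsCMField.complexConj L) v) (cmLocalForm L 3 v)),
        ∀ g, g ∈ Subgroup.centralizer ({γ} : Set ↥(unitaryGroupOfForm (conjLocal L (IsCMField.complexConj L) v) (cmLocalForm L 3 v))) ↔ x⁻¹ * g * x ∈ T)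
    (γ : ↥(unitaryGroupOfForm (conjLocal L (IsCMField.complexConj L) v) (cmLocalForm L 3 v))) (hreg : IsRegularElt (γ : GL (Fin 3) (LocalRing L v))) :
    (∃ (x : ↥(unitaryGroupOfForm (conjLocal L (IsCMField.complexConj L) v) (cmLocalForm L 3 v))) (m : ↥(cmBorelTriple L 3 v).M),
        IsRegularElt (((m : ↥(unitaryGroupOfForm (conjLocal L (IsCMField.complexConj L) v) (cmLocalForm L 3 v))) : GL (Fin 3) (LocalRing L v))) ∧
        x * (m : ↥(unitaryGroupOfForm (conjLocal L (IsCMField.complexConj L) v) (cmLocalForm L 3 v))) * x⁻¹ = γ ∧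
        ∀ g, g ∈ Subgroup.centralizer ({γ} : Set ↥(unitaryGroupOfForm (conjLocal L (IsCMField.complexConj L) v) (cmLocalForm L 3 v))) ↔
          x⁻¹ * g * x ∈ (cmBorelTriple L 3 v).M) ∨
    (∃ T ∈ S, IsCompact (T : Set ↥(unitaryGroupOfForm (conjLocal L (IsCMField.complexConj L) v) (cmLocalForm L 3 v))) ∧
      ∃ x : ↥(unitaryGroupOfForm (conjLocal L (IsCMField.complexConj L) v) (cmLocalForm L 3 v)),
        ∀ g, g ∈ Subgroup.centralizer ({γ} : Set ↥(unitaryGroupOfForm (conjLocal L (IsCMField.complexConj L) v) (cmLocalForm L 3 v))) ↔ x⁻¹ * g * x ∈ T) := by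
  by_cases hc : IsCompact ((Subgroup.centralizer ({γ} : Set ↥(unitaryGroupOfForm (conjLocal L (IsCMField.complexConj L) v) (cmLocalForm L 3 v)))) :
      Set ↥(unitaryGroupOfForm (conjLocal L (IsCMField.complexConj L) v) (cmLocalForm L 3 v)))
  · obtain ⟨T, hTS, x, hx⟩ := hcov γ hreg
    exact Or.inr ⟨T, hTS, (isCompact_iff_of_forall_mem_iff_conj hx).1 hc, x, hx⟩
  · exact Or.inl (exists_conj_cmTorus_of_not_isCompact_centralizer L v hns hreg hc)

/-- **The compact branch is exclusive**: if `Z(γ) = x T x⁻¹` with `T` compact, then `Z(γ)` is compact, hence `γ ∉ Ω` and `Z(γ)` is NOT conjugate to `M` (§1 + ★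
`isCompact_centralizer_iff_not_mem_hyperbolicSet`). [cite: Rogawski1990, §3.6 pp. 28–31; §12.5 p. 184] -/
theorem not_mem_hyperbolicSet_of_conj_isCompact (hns : ∀ w : PlacesOver L v, IsCMField.complexConj L • w.1 = w.1)
    {γ : ↥(unitaryGroupOfForm (conjLocal L (IsCMField.complexConj L) v) (cmLocalForm L 3 v))} (hreg : IsRegularElt (γ : GL (Fin 3) (LocalRing L v)))
    {T : Subgroup ↥(unitaryGroupOfForm (conjLocal L (IsCMField.complexConj L) v) (cmLocalForm L 3 v))}
    (hT : IsCompact (T : Set ↥(unitaryGroupOfForm (conjLocal L (IsCMField.complexConj L) v) (cmLocalForm L 3 v))))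
    {x : ↥(unitaryGroupOfForm (conjLocal L (IsCMField.complexConj L) v) (cmLocalForm L 3 v))}
    (hx : ∀ g, g ∈ Subgroup.centralizer ({γ} : Set ↥(unitaryGroupOfForm (conjLocal L (IsCMField.complexConj L) v) (cmLocalForm L 3 v))) ↔ x⁻¹ * g * x ∈ T) :
    (γ : Gqs L v) ∉ hyperbolicSet L v :=
  (isCompact_centralizer_iff_not_mem_hyperbolicSet L v hns (γ₀ := (γ : Gqs L v)) hreg).1 ((isCompact_iff_of_forall_mem_iff_conj hx).2 hT)

/-! ## §4 The normalised family as one `∃`: `M ∈ S'`, every other member compact (and from `S`), all Cartan, still covering, none conjugate to `M` -/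

set_option maxHeartbeats 800000 in  -- statement-level `whnf` on the CM carriers
/-- **«CARTAN-REPS-NORMALISE★» — the consumable form.**  From ANY finite family `S` of Cartan subgroups `Z(γ)` (`γ` regular) of `U(Φ₃)(L⁺_v)` (`v` non-split) meeting every
conjugacy class of Cartan subgroups, there is a finite family `S'` with: `M ∈ S'`; every other member is a COMPACT member of `S`; every member is a Cartan subgroup `Z(γ)`;
`S'` still meets every conjugacy class; and no member other than `M` is conjugate to `M`.  (`S' = insert M {T ∈ S | T compact}`; §1–§3.)  This is the shape
`cartanAll = insert M cartanG`, `cartanG` = compact centralisers of regular elements, that ★ S9a `F0P3cStCharTSCartanFields` (`hAll`, `hcart`) consumes — so the named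
fact N1 «CARTAN-FIN» may be cited in its bare form «finitely many conjugacy classes of Cartan subgroups». [cite: Rogawski1990, §3.6 pp. 28–31; §12.5 pp. 182, 184]
[cite: PlatonovRapinchuk1994, §6.4] -/
theorem exists_normalised_cartan_family (hns : ∀ w : PlacesOver L v, IsCMField.complexConj L • w.1 = w.1)
    (S : Finset (Subgroup ↥(unitaryGroupOfForm (conjLocal L (IsCMField.complexConj L) v) (cmLocalForm L 3 v))))
    (hS : ∀ T ∈ S, ∃ γ : ↥(unitaryGroupOfForm (conjLocal L (IsCMField.complexConj L) v) (cmLocalForm L 3 v)),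
      IsRegularElt (γ : GL (Fin 3) (LocalRing L v)) ∧ T = Subgroup.centralizer ({γ} : Set ↥(unitaryGroupOfForm (conjLocal L (IsCMField.complexConj L) v) (cmLocalForm L 3 v))))
    (hcov : ∀ γ : ↥(unitaryGroupOfForm (conjLocal L (IsCMField.complexConj L) v) (cmLocalForm L 3 v)), IsRegularElt (γ : GL (Fin 3) (LocalRing L v)) →
      ∃ T ∈ S, ∃ x : ↥(unitaryGroupOfForm (conjLocal L (IsCMField.complexConj L) v) (cmLocalForm L 3 v)),
        ∀ g, g ∈ Subgroup.centralizer ({γ} : Set ↥(unitaryGroupOfForm (conjLocal L (IsCMField.complexConj L) v) (cmLocalForm L 3 v))) ↔ x⁻¹ * g * x ∈ T) :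
    ∃ S' : Finset (Subgroup ↥(unitaryGroupOfForm (conjLocal L (IsCMField.complexConj L) v) (cmLocalForm L 3 v))),
      (cmBorelTriple L 3 v).M ∈ S' ∧
      (∀ T ∈ S', T = (cmBorelTriple L 3 v).M ∨ (T ∈ S ∧ IsCompact (T : Set ↥(unitaryGroupOfForm (conjLocal L (IsCMField.complexConj L) v) (cmLocalForm L 3 v))))) ∧
      (∀ T ∈ S', ∃ γ : ↥(unitaryGroupOfForm (conjLocal L (IsCMField.complexConj L) v) (cmLocalForm L 3 v)),
        IsRegularElt (γ : GL (Fin 3) (LocalRing L v)) ∧ T = Subgroup.centralizer ({γ} : Set ↥(unitaryGroupOfForm (conjLocal L (IsCMField.complexConj L) v) (cmLocalForm L 3 v)))) ∧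
      (∀ γ : ↥(unitaryGroupOfForm (conjLocal L (IsCMField.complexConj L) v) (cmLocalForm L 3 v)), IsRegularElt (γ : GL (Fin 3) (LocalRing L v)) →
        ∃ T ∈ S', ∃ x : ↥(unitaryGroupOfForm (conjLocal L (IsCMField.complexConj L) v) (cmLocalForm L 3 v)),
          ∀ g, g ∈ Subgroup.centralizer ({γ} : Set ↥(unitaryGroupOfForm (conjLocal L (IsCMField.complexConj L) v) (cmLocalForm L 3 v))) ↔ x⁻¹ * g * x ∈ T) ∧
      (∀ T ∈ S', T ≠ (cmBorelTriple L 3 v).M → ∀ x : ↥(unitaryGroupOfForm (conjLocal L (IsCMField.complexConj L) v) (cmLocalForm L 3 v)),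
        ¬ ∀ g, g ∈ T ↔ x⁻¹ * g * x ∈ (cmBorelTriple L 3 v).M) := by
  classical
  obtain ⟨m₀, hm₀M, hm₀reg, hZm₀⟩ := exists_isRegularElt_centralizer_eq_cmTorus L v hns
  refine ⟨insert (cmBorelTriple L 3 v).M
      (S.filter fun T => IsCompact (T : Set ↥(unitaryGroupOfForm (conjLocal L (IsCMField.complexConj L) v) (cmLocalForm L 3 v)))),
    Finset.mem_insert_self _ _, ?_, ?_, ?_, ?_⟩
  · intro T hT
    rcases Finset.mem_insert.1 hT with rfl | hT'
    · exact Or.inl rfl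
    · exact Or.inr (Finset.mem_filter.1 hT')
  · intro T hT
    rcases Finset.mem_insert.1 hT with rfl | hT'
    · exact ⟨m₀, hm₀reg, hZm₀.symm⟩
    · exact hS T (Finset.mem_filter.1 hT').1
  · intro γ hreg
    rcases conj_cmTorus_or_exists_isCompact_of_cover L v hns S hcov γ hreg with ⟨x, m, -, -, hiff⟩ | ⟨T, hTS, hTc, x, hx⟩
    · exact ⟨(cmBorelTriple L 3 v).M, Finset.mem_insert_self _ _, x, hiff⟩
    · exact ⟨T, Finset.mem_insert_of_mem (Finset.mem_filter.2 ⟨hTS, hTc⟩), x, hx⟩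
  · intro T hT hne x
    rcases Finset.mem_insert.1 hT with rfl | hT'
    · exact absurd rfl hne
    · exact not_conj_cmTorus_of_isCompact L v (Finset.mem_filter.1 hT').2 x

end U3

end Summit.HodgeConjecture.HodgeConjecture.Cruxes.H413.F0P3cStCharTSCartanReps

end
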